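import Literature.Probability.RandomPlanarGeometry.SAWCountZdSymbolBlockData
import Literature.Probability.RandomPlanarGeometry.SAWCountZdSymbolSecondCoefficient
import HarnessLib

/-!
# THE SECOND-LAYER LOWER CENSUS: `3·V'_j = (2j−4)(j+3)(2j−5)‼·2^{2j−3}` for every `j ≥ 3` — one outside triple, or a block axis with a third occurrence

Topic `Literature/Probability/RandomPlanarGeometry` (the «SYMBOL POLYNOMIALITY» programme; on `SAWCountZdSymbolBlockData.lean` (a-p1 g26: the one-block bijection
`card_shapeClass_topVec : #shapeClass j m (topVec m p) = #goodParts m j p · 2^{m−2}`, `goodParts`, `freePos`), `SAWCountZdSymbolSecondCoefficient.lean` (a-p1 g26: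
`secondShapeSumBelow`), λ1 `SAWCountZdSymbolTopShapes.lean` (`exists_eq_topVec_of_mem_shapeClass`, `adjValid_topVec`, `breaks_topVec`, `topVec_injOn`), the set
partitions of `HardCoreUrsell.lean` and the perfect matchings `pairPartitions` / `card_pairPartitions_of_card_eq_two_mul` of `HiggsFluctMeasureWickPairings.lean`
(Glimm–Jaffe (3.2.13): `(2n−1)‼` pairings)).

PRINTED CONTEXT (locators only; nothing is quoted digit-for-digit). Madras–Slade (1993) §1.1 eq. (1.1.8) p. 5, Definition 1.2.4, §1.2 p. 10; Clisby–Liang–Slade (2007)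
§3.3 eqs. (29)/(31); Glimm–Jaffe, Quantum Physics (1987) (3.2.13) (the `(2n−1)‼` pairings). NOT IN PRINT as far as the lane's desks could locate: the statements below.

THE THEOREM. The second-layer lower corner of the symbol polynomial `R_j` (`SAWCountZdSymbolSecondCoefficient.coeff_symbolPoly_two_mul_sub_four`) is the sum
`V'_j = secondShapeSumBelow j` of the shape-class sizes on `2j − 1` letters with `2j − 4` breaks. Such a class is non-empty only for a one-block adjacency vector
`topVec (2j−1) p` (λ1), and by the one-block bijection its size is `#goodParts (2j−1) j p · 2^{2j−3}`. HERE the good partitions are COUNTED: writing a good partition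
as `(A, B, ρ)` — `A`, `B` the outside parts of the blocks of `p`, `p+1`, `ρ` the remaining partition of the `2j − 5 − #A − #B` other outside positions into `j − 3`
blocks of size `≥ 2` (★★ `card_goodParts_eq_card_abData`, a bijection for every `m`) — only `#A + #B ≤ 1` leaves enough letters: `A = B = ∅` and `ρ` = one TRIPLE
+ pairs (`twoParts` on `2k+1` points: ★ `card_twoParts_of_card_eq_succ` = `C(2k+1,3)(2k−3)‼`, bijection with (triple, matching of the rest)), or exactly one of
`A`, `B` a singleton and `ρ` a perfect matching (`card_twoParts_of_card_eq` = `(2k−1)‼`). So ★★ `three_mul_card_abData`: `3·#abData = (j+3)(2j−5)‼`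
(`secondLower_arith`: `3[C(2k+1,3)(2k−3)‼ + 2(2k+1)(2k−1)‼] = (k+6)(2k+1)‼`), ★★★ `three_mul_card_shapeClass_secondLower`:
**`3·#shapeClass j (2j−1) (topVec (2j−1) p) = (j+3)(2j−5)‼·2^{2j−3}`** for every `p + 4 ≤ 2j − 1`, and ★★★ `three_mul_secondShapeSumBelow`:
**`3·V'_j = (2j−4)(j+3)(2j−5)‼·2^{2j−3}` for every `j ≥ 3`** — the lane's census values `V'_4 = 896`, `V'_5 = 30720`, `V'_6 = 1290240` (tree `shM_eq_lit`
tables) and the BLIND-PREDICTED `V'_7 = M_7(13,10) = 64 512 000` (register «Am. BQ» BQ-1, kit j306081 HIT) are its instances. This is the second conjunct of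
`SecondLayerSums j` of `SAWCountZdSymbolSecondCancellation.lean` for every `j`; the first conjunct (`U'_j`, four adjacencies on `2j` letters) remains.
Tool notions (the lane's): `twoParts`, `tripleData`, `tripleOf`, `outerPos`, `abData`, `abOf`, `ofAB`.

THIS FILE (lane «pcv-sawmu», a-p1 g26; all PROVED, standard axioms): `twoParts`, `mem_twoParts`, `sum_card_sub_two_of_mem_twoParts`, `twoParts_eq_empty_of_lt`,
`twoParts_eq_pairPartitions`, `card_twoParts_of_card_eq`, ★ `exists_unique_triple_of_mem_twoParts`, `tripleData`, `tripleOf`, `tripleOf_eq`, ★ `card_twoParts_of_card_eq_succ`,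
`outerPos`, `abData`, `mem_outerPos`, `p_mem_freePos`, `abOf`, `ofAB`, `freePos_sdiff_sdiff`, ★ `abOf_mem_abData`, ★ `ofAB_mem_goodParts`, ★★ `card_goodParts_eq_card_abData`,
`card_outerPos`, `card_sdiff_union` (private), `secondLower_arith` (private), ★ `sum_card_twoParts_pairs`, ★★ `three_mul_card_abData`, ★★ `three_mul_card_goodParts_secondLower`,
★★★ `three_mul_card_shapeClass_secondLower`, ★★★ `three_mul_secondShapeSumBelow`.
[cite: MadrasSlade1993, §1.1 eq. (1.1.8) p. 5; Definition 1.2.4; §1.2 (p. 10)] [cite: ClisbyLiangSlade2007, §3.3 eqs. (29)/(31)] [cite: GlimmJaffeQP1987, (3.2.13) §3.2]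

Provenance: lane «pcv-sawmu», a-p1 g26 (2026-08-28).
-/

open Finset
open scoped BigOperators
open Literature.Probability.LatticeModels
open Literature.Probability.RandomPlanarGeometry.SAW
open Literature.Probability.Percolation
open Literature.MathematicalPhysics.QuantumFieldTheory.Balaban1983to89
open Literature.MathematicalPhysics.QuantumFieldTheory.Balaban1983to89.HiggsFluctMeasureWickPairings

namespace Literature.Probability.RandomPlanarGeometry.SAW.Zd

namespace WordTypes

variable {m : ℕ}

/-! ### Set partitions with all blocks of size ≥ 2 and a prescribed number of blocks -/

open Classical in
/-- The set partitions of `W` into `k` blocks, all of size at least two. [cite: MadrasSlade1993, Definition 1.2.4; lane tool notion] -/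
noncomputable def twoParts (W : Finset (Fin m)) (k : ℕ) : Finset (Finset (Finset (Fin m))) :=
  (setPartitions W).filter fun ρ => (∀ B ∈ ρ, 2 ≤ B.card) ∧ ρ.card = k

/-- Membership in `twoParts`. [cite: MadrasSlade1993, Definition 1.2.4; lane plumbing] -/
theorem mem_twoParts {W : Finset (Fin m)} {k : ℕ} {ρ : Finset (Finset (Fin m))} :
    ρ ∈ twoParts W k ↔ IsSetPartition W ρ ∧ (∀ B ∈ ρ, 2 ≤ B.card) ∧ ρ.card = k := by
  classical
  unfold twoParts; rw [Finset.mem_filter, mem_setPartitions]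

/-- The excess identity: for `ρ ∈ twoParts W k`, `Σ_{B ∈ ρ} (#B − 2) + 2k = #W`. [cite: MadrasSlade1993, Definition 1.2.4; lane plumbing] -/
theorem sum_card_sub_two_of_mem_twoParts {W : Finset (Fin m)} {k : ℕ} {ρ : Finset (Finset (Fin m))} (h : ρ ∈ twoParts W k) :
    ∑ B ∈ ρ, (B.card - 2) + 2 * k = W.card := by
  rw [mem_twoParts] at h
  obtain ⟨hρ, h2, hk⟩ := h
  rw [← hρ.sum_card, ← hk, Finset.card_eq_sum_ones ρ, Finset.mul_sum, ← Finset.sum_add_distrib]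
  exact Finset.sum_congr rfl fun B hB => by have := h2 B hB; omega

/-- (G0) Too few elements: `twoParts W k = ∅` when `#W < 2k`. [cite: MadrasSlade1993, Definition 1.2.4; lane lemma] -/
theorem twoParts_eq_empty_of_lt {W : Finset (Fin m)} {k : ℕ} (hW : W.card < 2 * k) : twoParts W k = ∅ := by
  rw [Finset.eq_empty_iff_forall_notMem]
  intro ρ hρ
  have := sum_card_sub_two_of_mem_twoParts hρ
  omega

/-- (G1) Exactly `2k` elements: `twoParts W k` is the set of perfect matchings of `W`. [cite: MadrasSlade1993, Definition 1.2.4; lane lemma] -/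
theorem twoParts_eq_pairPartitions {W : Finset (Fin m)} {k : ℕ} (hW : W.card = 2 * k) : twoParts W k = pairPartitions W := by
  classical
  ext ρ
  rw [mem_twoParts, mem_pairPartitions]
  constructor
  · rintro ⟨hρ, h2, hk⟩
    refine ⟨hρ, fun B hB => ?_⟩
    have hsum := sum_card_sub_two_of_mem_twoParts (mem_twoParts.2 ⟨hρ, h2, hk⟩)
    have h0 : ∑ B ∈ ρ, (B.card - 2) = 0 := by omega
    have := Finset.sum_eq_zero_iff.1 h0 B hB
    have := h2 B hB
    omega
  · rintro ⟨hρ, h2⟩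
    refine ⟨hρ, fun B hB => (h2 B hB).ge, ?_⟩
    have := card_eq_two_mul_of_mem_pairPartitions (mem_pairPartitions.2 ⟨hρ, h2⟩)
    omega

/-- (G1) count: `#twoParts W k = (2k−1)‼` when `#W = 2k`. [cite: MadrasSlade1993, Definition 1.2.4; lane lemma] -/
theorem card_twoParts_of_card_eq {W : Finset (Fin m)} {k : ℕ} (hW : W.card = 2 * k) : (twoParts W k).card = (2 * k - 1).doubleFactorial := by
  rw [twoParts_eq_pairPartitions hW, card_pairPartitions_of_card_eq_two_mul hW]

/-! ### (G2) `2k + 1` elements: one block of size three, the rest pairs -/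

/-- In `ρ ∈ twoParts W k` with `#W = 2k + 1` there is exactly one block of size `≥ 3`, and it has size `3`.
[cite: MadrasSlade1993, Definition 1.2.4; lane lemma] -/
theorem exists_unique_triple_of_mem_twoParts {W : Finset (Fin m)} {k : ℕ} (hW : W.card = 2 * k + 1) {ρ : Finset (Finset (Fin m))}
    (h : ρ ∈ twoParts W k) : ∃ T ∈ ρ, T.card = 3 ∧ ∀ B ∈ ρ, B ≠ T → B.card = 2 := by
  have hsum := sum_card_sub_two_of_mem_twoParts h
  rw [mem_twoParts] at h
  obtain ⟨hρ, h2, hk⟩ := h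
  have h1 : ∑ B ∈ ρ, (B.card - 2) = 1 := by omega
  -- some term is positive
  obtain ⟨T, hT, hTpos⟩ : ∃ T ∈ ρ, 0 < T.card - 2 := by
    by_contra hne
    push Not at hne
    have : ∑ B ∈ ρ, (B.card - 2) = 0 := Finset.sum_eq_zero fun B hB => by have := hne B hB; omega
    omega
  have hTle : T.card - 2 ≤ 1 := by
    rw [← h1]; exact Finset.single_le_sum (f := fun B : Finset (Fin m) => B.card - 2) (fun B _ => Nat.zero_le _) hT
  refine ⟨T, hT, by have := h2 T hT; omega, fun B hB hBT => ?_⟩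
  have hB2 := h2 B hB
  by_contra hB3
  have hBpos : 1 ≤ B.card - 2 := by omega
  -- two distinct positive terms force the sum above 1
  have : T.card - 2 + (B.card - 2) ≤ ∑ B ∈ ρ, (B.card - 2) := by
    rw [← Finset.sum_pair (f := fun B : Finset (Fin m) => B.card - 2) hBT.symm]
    exact Finset.sum_le_sum_of_subset_of_nonneg (fun x hx => by
      rw [Finset.mem_insert, Finset.mem_singleton] at hx; rcases hx with rfl | rfl <;> assumption) (fun _ _ _ => Nat.zero_le _)
  omega

open Classical in
/-- The triple data: a `3`-subset `t ⊆ W` and a perfect matching of `W ∖ t`. [cite: MadrasSlade1993, Definition 1.2.4; lane tool notion] -/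
noncomputable def tripleData (W : Finset (Fin m)) : Finset (Σ _ : Finset (Fin m), Finset (Finset (Fin m))) :=
  (W.powersetCard 3).sigma fun t => pairPartitions (W \ t)

open Classical in
/-- The unique triple of `ρ` (junk `∅` if none). [cite: MadrasSlade1993, Definition 1.2.4; lane tool notion] -/
noncomputable def tripleOf (ρ : Finset (Finset (Fin m))) : Finset (Fin m) :=
  if h : ∃ T ∈ ρ, T.card = 3 then h.choose else ∅

/-- `tripleOf ρ` is the size-3 block when there is exactly one. [cite: MadrasSlade1993, Definition 1.2.4; lane plumbing] -/
theorem tripleOf_eq {ρ : Finset (Finset (Fin m))} {T : Finset (Fin m)} (hT : T ∈ ρ) (hT3 : T.card = 3) (huniq : ∀ B ∈ ρ, B ≠ T → B.card = 2) :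
    tripleOf ρ = T := by
  classical
  have hex : ∃ T ∈ ρ, T.card = 3 := ⟨T, hT, hT3⟩
  unfold tripleOf
  rw [dif_pos hex]
  by_contra hne
  have := huniq _ hex.choose_spec.1 hne
  have := hex.choose_spec.2
  omega

/-- (G2) count: `#twoParts W k = C(2k+1, 3)·(2k−3)‼` when `#W = 2k + 1` (bijection with the triple data).
[cite: MadrasSlade1993, Definition 1.2.4; lane lemma] -/
theorem card_twoParts_of_card_eq_succ {W : Finset (Fin m)} {k : ℕ} (hW : W.card = 2 * k + 1) :
    (twoParts W k).card = (2 * k + 1).choose 3 * (2 * k - 3).doubleFactorial := by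
  classical
  have htarget : (tripleData W).card = (2 * k + 1).choose 3 * (2 * k - 3).doubleFactorial := by
    unfold tripleData
    rw [Finset.card_sigma, Finset.sum_const_nat (m := (2 * k - 3).doubleFactorial), Finset.card_powersetCard, hW]
    intro t ht
    rw [Finset.mem_powersetCard] at ht
    rcases Nat.lt_or_ge k 1 with hk | hk
    · -- k = 0: no 3-subset of a 1-set
      exfalso; have := Finset.card_le_card ht.1; omega
    · rw [card_pairPartitions_of_card_eq_two_mul (n := k - 1) (by rw [Finset.card_sdiff_of_subset ht.1, hW, ht.2]; omega)]
      congr 1; omega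
  rw [← htarget]
  refine Finset.card_nbij' (fun ρ => ⟨tripleOf ρ, ρ.erase (tripleOf ρ)⟩) (fun d => insert d.1 d.2) (fun ρ hρ => ?_) (fun d hd => ?_)
    (fun ρ hρ => ?_) (fun d hd => ?_)
  · -- into the triple data
    obtain ⟨T, hT, hT3, huniq⟩ := exists_unique_triple_of_mem_twoParts hW hρ
    have hρ' := (mem_twoParts.1 hρ).1
    dsimp only
    rw [tripleOf_eq hT hT3 huniq]
    unfold tripleData
    rw [Finset.mem_coe, Finset.mem_sigma, Finset.mem_powersetCard, mem_pairPartitions]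
    exact ⟨⟨hρ'.subset hT, hT3⟩, hρ'.erase hT, fun B hB => huniq B (Finset.mem_of_mem_erase hB) (Finset.ne_of_mem_erase hB)⟩
  · -- from the triple data
    obtain ⟨t, σ⟩ := d
    unfold tripleData at hd
    rw [Finset.mem_coe, Finset.mem_sigma, Finset.mem_powersetCard, mem_pairPartitions] at hd
    obtain ⟨⟨htW, ht3⟩, hσ, hσ2⟩ := hd
    dsimp only at htW ht3 hσ hσ2 ⊢
    have hins : IsSetPartition W (insert t σ) := hσ.insert htW (by rw [← Finset.card_pos, ht3]; norm_num)
    rw [Finset.mem_coe, mem_twoParts]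
    have htσ : t ∉ σ := hσ.notMem_of_sdiff (by rw [← Finset.card_pos, ht3]; norm_num)
    refine ⟨hins, fun B hB => ?_, ?_⟩
    · rcases Finset.mem_insert.1 hB with hBt | hB
      · rw [hBt, ht3]; norm_num
      · rw [hσ2 B hB]
    · rw [Finset.card_insert_of_notMem htσ]
      have := card_eq_two_mul_of_mem_pairPartitions (mem_pairPartitions.2 ⟨hσ, hσ2⟩)
      rw [Finset.card_sdiff_of_subset htW, hW, ht3] at this
      have := Finset.card_le_card htW
      rw [hW, ht3] at this
      omega
  · -- left inverse
    obtain ⟨T, hT, hT3, huniq⟩ := exists_unique_triple_of_mem_twoParts hW hρ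
    simp only [tripleOf_eq hT hT3 huniq, Finset.insert_erase hT]
  · -- right inverse
    obtain ⟨t, σ⟩ := d
    unfold tripleData at hd
    rw [Finset.mem_coe, Finset.mem_sigma, Finset.mem_powersetCard, mem_pairPartitions] at hd
    obtain ⟨⟨htW, ht3⟩, hσ, hσ2⟩ := hd
    dsimp only at htW ht3 hσ hσ2 ⊢
    have htσ : t ∉ σ := hσ.notMem_of_sdiff (by rw [← Finset.card_pos, ht3]; norm_num)
    have htr : tripleOf (insert t σ) = t :=
      tripleOf_eq (Finset.mem_insert_self _ _) ht3 (fun B hB hBt => by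
        rcases Finset.mem_insert.1 hB with rfl | hB
        · exact absurd rfl hBt
        · exact hσ2 B hB)
    simp only [htr, Finset.erase_insert htσ]

/-! ### A good partition is (A, B, ρ): the outside parts of the blocks of `p`, `p+1`, and the remaining partition -/

section AB

variable {p : ℕ}

open Classical in
/-- The outside positions among the free ones: `freePos ∖ {p, p+1}`. [cite: MadrasSlade1993, Definition 1.2.4; lane tool notion] -/
noncomputable def outerPos (m p : ℕ) (hp : p + 4 ≤ m) : Finset (Fin m) := ((freePos m p).erase ⟨p, by omega⟩).erase ⟨p + 1, by omega⟩

open Classical in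
/-- The (A, B, ρ) data: disjoint `A, B ⊆ outerPos` and a partition of the rest into `m − j − 2` blocks of size `≥ 2`.
[cite: MadrasSlade1993, Definition 1.2.4; lane tool notion] -/
noncomputable def abData (m j p : ℕ) (hp : p + 4 ≤ m) : Finset (Σ _ : Finset (Fin m) × Finset (Fin m), Finset (Finset (Fin m))) :=
  (((outerPos m p hp).powerset ×ˢ (outerPos m p hp).powerset).filter fun AB => Disjoint AB.1 AB.2).sigma
    fun AB => twoParts (outerPos m p hp \ (AB.1 ∪ AB.2)) (m - j - 2)

/-- Membership in `outerPos`. [cite: MadrasSlade1993, Definition 1.2.4; lane plumbing] -/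
theorem mem_outerPos (hp : p + 4 ≤ m) {q : Fin m} : q ∈ outerPos m p hp ↔ q ∈ freePos m p ∧ q.val ≠ p ∧ q.val ≠ p + 1 := by
  unfold outerPos
  rw [Finset.mem_erase, Finset.mem_erase]
  simp only [ne_eq, Fin.ext_iff]
  tauto

/-- `p`, `p+1` are free positions. [cite: MadrasSlade1993, Definition 1.2.4; lane plumbing] -/
theorem p_mem_freePos (hp : p + 4 ≤ m) : (⟨p, by omega⟩ : Fin m) ∈ freePos m p ∧ (⟨p + 1, by omega⟩ : Fin m) ∈ freePos m p := by
  unfold freePos; simp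

open Classical in
/-- The forgetful map `π ↦ ((P₀ ∖ p, P₁ ∖ (p+1)), π ∖ {P₀, P₁})`. [cite: MadrasSlade1993, Definition 1.2.4; lane tool notion] -/
noncomputable def abOf (hp : p + 4 ≤ m) (π : Finset (Finset (Fin m))) : (Σ _ : Finset (Fin m) × Finset (Fin m), Finset (Finset (Fin m))) :=
  ⟨((blockOf π (⟨p, by omega⟩ : Fin m)).erase ⟨p, by omega⟩, (blockOf π (⟨p + 1, by omega⟩ : Fin m)).erase ⟨p + 1, by omega⟩),
    (π.erase (blockOf π (⟨p, by omega⟩ : Fin m))).erase (blockOf π (⟨p + 1, by omega⟩ : Fin m))⟩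

/-- The rebuilding map `((A, B), ρ) ↦ insert ({p} ∪ A) (insert ({p+1} ∪ B) ρ)`. [cite: MadrasSlade1993, Definition 1.2.4; lane tool notion] -/
def ofAB (hp : p + 4 ≤ m) (d : Σ _ : Finset (Fin m) × Finset (Fin m), Finset (Finset (Fin m))) : Finset (Finset (Fin m)) :=
  insert (insert (⟨p, by omega⟩ : Fin m) d.1.1) (insert (insert (⟨p + 1, by omega⟩ : Fin m) d.1.2) d.2)

/-- The set identity behind both directions: `F ∖ ({p} ∪ A) ∖ ({p+1} ∪ B) = outerPos ∖ (A ∪ B)`.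
[cite: MadrasSlade1993, Definition 1.2.4; lane plumbing] -/
theorem freePos_sdiff_sdiff (hp : p + 4 ≤ m) (A B : Finset (Fin m)) :
    (freePos m p \ insert (⟨p, by omega⟩ : Fin m) A) \ insert (⟨p + 1, by omega⟩ : Fin m) B = outerPos m p hp \ (A ∪ B) := by
  ext q
  simp only [Finset.mem_sdiff, Finset.mem_insert, Finset.mem_union, mem_outerPos hp, not_or, Fin.ext_iff]
  tauto

open Classical in
/-- ★ The forgetful map lands in the (A, B, ρ) data. [cite: MadrasSlade1993, Definition 1.2.4; lane lemma] -/
theorem abOf_mem_abData {j : ℕ} (hp : p + 4 ≤ m) {π : Finset (Finset (Fin m))} (hπ : π ∈ goodParts m j p hp) : abOf hp π ∈ abData m j p hp := by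
  unfold goodParts at hπ
  rw [Finset.mem_filter, mem_setPartitions] at hπ
  obtain ⟨hπ, hsep, h2, hcard⟩ := hπ
  obtain ⟨hp0, hp1⟩ := p_mem_freePos (m := m) hp
  set P₀ := blockOf π (⟨p, by omega⟩ : Fin m) with hP₀
  set P₁ := blockOf π (⟨p + 1, by omega⟩ : Fin m) with hP₁
  have hP₀π : P₀ ∈ π := hπ.blockOf_mem hp0
  have hP₁π : P₁ ∈ π := hπ.blockOf_mem hp1
  have hp0P : (⟨p, by omega⟩ : Fin m) ∈ P₀ := hπ.mem_blockOf hp0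
  have hp1P : (⟨p + 1, by omega⟩ : Fin m) ∈ P₁ := hπ.mem_blockOf hp1
  have hp1P₀ : (⟨p + 1, by omega⟩ : Fin m) ∉ P₀ := fun h => hsep ((hπ.eq_blockOf hP₀π h).symm ▸ rfl)
  have hp0P₁ : (⟨p, by omega⟩ : Fin m) ∉ P₁ := fun h => hsep (hπ.eq_blockOf hP₁π h)
  have hdisj : Disjoint P₀ P₁ := hπ.disjoint hP₀π hP₁π hsep
  have hA : insert (⟨p, by omega⟩ : Fin m) (P₀.erase ⟨p, by omega⟩) = P₀ := Finset.insert_erase hp0P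
  have hB : insert (⟨p + 1, by omega⟩ : Fin m) (P₁.erase ⟨p + 1, by omega⟩) = P₁ := Finset.insert_erase hp1P
  unfold abData abOf
  rw [Finset.mem_sigma, Finset.mem_filter, Finset.mem_product, Finset.mem_powerset, Finset.mem_powerset]
  refine ⟨⟨⟨fun q hq => ?_, fun q hq => ?_⟩, ?_⟩, ?_⟩
  · rw [Finset.mem_erase] at hq
    rw [mem_outerPos hp]
    refine ⟨hπ.subset hP₀π hq.2, fun h => hq.1 (Fin.ext h), fun h => hp1P₀ ?_⟩
    have : q = ⟨p + 1, by omega⟩ := Fin.ext h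
    exact this ▸ hq.2
  · rw [Finset.mem_erase] at hq
    rw [mem_outerPos hp]
    refine ⟨hπ.subset hP₁π hq.2, fun h => hp0P₁ ?_, fun h => hq.1 (Fin.ext h)⟩
    have : q = ⟨p, by omega⟩ := Fin.ext h
    exact this ▸ hq.2
  · simp only
    exact Finset.disjoint_of_subset_left (Finset.erase_subset _ _) (Finset.disjoint_of_subset_right (Finset.erase_subset _ _) hdisj)
  · simp only
    rw [mem_twoParts, ← freePos_sdiff_sdiff hp, hA, hB]
    refine ⟨(hπ.erase hP₀π).erase (Finset.mem_erase.2 ⟨fun h => hsep h.symm, hP₁π⟩), fun B' hB' => ?_, ?_⟩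
    · have hB'π : B' ∈ π := Finset.mem_of_mem_erase (Finset.mem_of_mem_erase hB')
      have hne1 : B' ≠ P₁ := Finset.ne_of_mem_erase hB'
      have hne0 : B' ≠ P₀ := Finset.ne_of_mem_erase (Finset.mem_of_mem_erase hB')
      refine h2 B' hB'π (fun h => hne0 (hπ.eq_blockOf hB'π h).symm) (fun h => hne1 (hπ.eq_blockOf hB'π h).symm)
    · rw [Finset.card_erase_of_mem (Finset.mem_erase.2 ⟨fun h => hsep h.symm, hP₁π⟩), Finset.card_erase_of_mem hP₀π]
      omega

open Classical in
/-- ★ The rebuilding map lands in the good partitions (`j + 2 ≤ m`). [cite: MadrasSlade1993, Definition 1.2.4; lane lemma] -/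
theorem ofAB_mem_goodParts {j : ℕ} (hp : p + 4 ≤ m) (hmj : j + 2 ≤ m) {d : Σ _ : Finset (Fin m) × Finset (Fin m), Finset (Finset (Fin m))}
    (hd : d ∈ abData m j p hp) : ofAB hp d ∈ goodParts m j p hp := by
  obtain ⟨⟨A, B⟩, ρ⟩ := d
  unfold abData at hd
  rw [Finset.mem_sigma, Finset.mem_filter, Finset.mem_product, Finset.mem_powerset, Finset.mem_powerset, mem_twoParts] at hd
  obtain ⟨⟨⟨hA, hB⟩, hdisj⟩, hρ, h2, hk⟩ := hd
  simp only at hA hB hdisj hρ h2 hk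
  obtain ⟨hp0, hp1⟩ := p_mem_freePos (m := m) hp
  set P₀ : Finset (Fin m) := insert ⟨p, by omega⟩ A with hP₀
  set P₁ : Finset (Fin m) := insert ⟨p + 1, by omega⟩ B with hP₁
  rw [← freePos_sdiff_sdiff hp] at hρ
  -- insert P₁, then P₀
  have hP₁sub : P₁ ⊆ freePos m p \ P₀ := by
    intro q hq
    rw [Finset.mem_sdiff]
    rcases Finset.mem_insert.1 hq with rfl | hqB
    · refine ⟨hp1, fun h => ?_⟩
      rcases Finset.mem_insert.1 h with h | h
      · simp [Fin.ext_iff] at h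
      · exact ((mem_outerPos hp).1 (hA h)).2.2 rfl
    · refine ⟨((mem_outerPos hp).1 (hB hqB)).1, fun h => ?_⟩
      rcases Finset.mem_insert.1 h with h | h
      · exact ((mem_outerPos hp).1 (hB hqB)).2.1 (by rw [h])
      · exact Finset.disjoint_left.1 hdisj h hqB
  have hκ : IsSetPartition (freePos m p \ P₀) (insert P₁ ρ) := hρ.insert hP₁sub ⟨_, Finset.mem_insert_self _ _⟩
  have hP₀sub : P₀ ⊆ freePos m p := by
    intro q hq
    rcases Finset.mem_insert.1 hq with rfl | hqA
    · exact hp0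
    · exact ((mem_outerPos hp).1 (hA hqA)).1
  have hπ : IsSetPartition (freePos m p) (ofAB hp ⟨(A, B), ρ⟩) := hκ.insert hP₀sub ⟨_, Finset.mem_insert_self _ _⟩
  have hP₁ρ : P₁ ∉ ρ := hρ.notMem_of_sdiff ⟨_, Finset.mem_insert_self _ _⟩
  have hP₀κ : P₀ ∉ insert P₁ ρ := hκ.notMem_of_sdiff ⟨_, Finset.mem_insert_self _ _⟩
  have hne : P₀ ≠ P₁ := by
    intro h
    have : (⟨p, by omega⟩ : Fin m) ∈ P₁ := h ▸ Finset.mem_insert_self _ _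
    rcases Finset.mem_insert.1 this with h' | h'
    · simp [Fin.ext_iff] at h'
    · exact ((mem_outerPos hp).1 (hB h')).2.1 rfl
  unfold goodParts
  rw [Finset.mem_filter, mem_setPartitions]
  have hb0 : blockOf (ofAB hp ⟨(A, B), ρ⟩) (⟨p, by omega⟩ : Fin m) = P₀ :=
    hπ.eq_blockOf (Finset.mem_insert_self _ _) (Finset.mem_insert_self _ _)
  have hb1 : blockOf (ofAB hp ⟨(A, B), ρ⟩) (⟨p + 1, by omega⟩ : Fin m) = P₁ :=
    hπ.eq_blockOf (Finset.mem_insert_of_mem (Finset.mem_insert_self _ _)) (Finset.mem_insert_self _ _)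
  refine ⟨hπ, ?_, fun B' hB' hq0 hq1 => ?_, ?_⟩
  · rw [hb0, hb1]; exact hne
  · unfold ofAB at hB'
    rcases Finset.mem_insert.1 hB' with rfl | hB'
    · exact absurd (Finset.mem_insert_self _ _) hq0
    · rcases Finset.mem_insert.1 hB' with rfl | hB'
      · exact absurd (Finset.mem_insert_self _ _) hq1
      · exact h2 B' hB'
  · unfold ofAB
    simp only
    rw [Finset.card_insert_of_notMem hP₀κ, Finset.card_insert_of_notMem hP₁ρ, hk]
    omega

open Classical in
/-- ★★ THE GOOD PARTITIONS ARE IN BIJECTION WITH THE (A, B, ρ) DATA (`j + 2 ≤ m`). [cite: MadrasSlade1993, Definition 1.2.4; lane theorem] -/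
theorem card_goodParts_eq_card_abData {j : ℕ} (hp : p + 4 ≤ m) (hmj : j + 2 ≤ m) :
    (goodParts m j p hp).card = (abData m j p hp).card := by
  refine Finset.card_nbij' (abOf hp) (ofAB hp) (fun π hπ => abOf_mem_abData hp hπ) (fun d hd => ofAB_mem_goodParts hp hmj hd)
    (fun π hπ => ?_) (fun d hd => ?_)
  · -- left inverse
    rw [Finset.mem_coe] at hπ
    unfold goodParts at hπ
    rw [Finset.mem_filter, mem_setPartitions] at hπ
    obtain ⟨hπ, hsep, -, -⟩ := hπ
    obtain ⟨hp0, hp1⟩ := p_mem_freePos (m := m) hp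
    have hP₀π := hπ.blockOf_mem hp0
    have hP₁π := hπ.blockOf_mem hp1
    unfold ofAB abOf
    simp only
    rw [Finset.insert_erase (hπ.mem_blockOf hp0), Finset.insert_erase (hπ.mem_blockOf hp1),
      Finset.insert_erase (Finset.mem_erase.2 ⟨fun h => hsep h.symm, hP₁π⟩), Finset.insert_erase hP₀π]
  · -- right inverse
    obtain ⟨⟨A, B⟩, ρ⟩ := d
    rw [Finset.mem_coe] at hd
    have hgood := ofAB_mem_goodParts hp hmj hd
    unfold abData at hd
    rw [Finset.mem_sigma, Finset.mem_filter, Finset.mem_product, Finset.mem_powerset, Finset.mem_powerset, mem_twoParts] at hd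
    obtain ⟨⟨⟨hA, hB⟩, hdisj⟩, hρ, -, -⟩ := hd
    simp only at hA hB hdisj hρ
    unfold goodParts at hgood
    rw [Finset.mem_filter, mem_setPartitions] at hgood
    obtain ⟨hπ, hsep, -, -⟩ := hgood
    have hb0 : blockOf (ofAB hp ⟨(A, B), ρ⟩) (⟨p, by omega⟩ : Fin m) = insert ⟨p, by omega⟩ A :=
      hπ.eq_blockOf (Finset.mem_insert_self _ _) (Finset.mem_insert_self _ _)
    have hb1 : blockOf (ofAB hp ⟨(A, B), ρ⟩) (⟨p + 1, by omega⟩ : Fin m) = insert ⟨p + 1, by omega⟩ B :=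
      hπ.eq_blockOf (Finset.mem_insert_of_mem (Finset.mem_insert_self _ _)) (Finset.mem_insert_self _ _)
    have hpA : (⟨p, by omega⟩ : Fin m) ∉ A := fun h => ((mem_outerPos hp).1 (hA h)).2.1 rfl
    have hpB : (⟨p + 1, by omega⟩ : Fin m) ∉ B := fun h => ((mem_outerPos hp).1 (hB h)).2.2 rfl
    rw [← freePos_sdiff_sdiff hp] at hρ
    have hP₁ρ : insert (⟨p + 1, by omega⟩ : Fin m) B ∉ ρ := hρ.notMem_of_sdiff ⟨_, Finset.mem_insert_self _ _⟩
    have hne : insert (⟨p, by omega⟩ : Fin m) A ≠ insert ⟨p + 1, by omega⟩ B := by rw [← hb0, ← hb1]; exact hsep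
    have hP₀κ : insert (⟨p, by omega⟩ : Fin m) A ∉ insert (insert (⟨p + 1, by omega⟩ : Fin m) B) ρ := by
      intro h
      rcases Finset.mem_insert.1 h with h | h
      · exact hne h
      · have := hρ.subset h (Finset.mem_insert_self _ _)
        rw [Finset.mem_sdiff, Finset.mem_sdiff] at this
        exact this.1.2 (Finset.mem_insert_self _ _)
    unfold abOf
    rw [hb0, hb1, Finset.erase_insert hpA, Finset.erase_insert hpB]
    unfold ofAB
    simp only
    rw [Finset.erase_insert hP₀κ, Finset.erase_insert hP₁ρ]

end AB

/-! ### Counting the (A, B, ρ) data on `2j − 1` letters: one outside triple, or `p`/`p+1` joined to one outside position -/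

section Count

variable {p : ℕ}

/-- `#outerPos = m − 4`. [cite: MadrasSlade1993, Definition 1.2.4; lane plumbing] -/
theorem card_outerPos (hp : p + 4 ≤ m) : (outerPos m p hp).card = m - 4 := by
  obtain ⟨hp0, hp1⟩ := p_mem_freePos (m := m) hp
  unfold outerPos
  rw [Finset.card_erase_of_mem (Finset.mem_erase.2 ⟨by simp [Fin.ext_iff], hp1⟩), Finset.card_erase_of_mem hp0, card_freePos hp]
  omega

/-- The size of the remaining set: `#(O ∖ (A ∪ B)) = #O − #A − #B` for disjoint `A, B ⊆ O`. [cite: MadrasSlade1993, Definition 1.2.4; lane plumbing] -/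
private theorem card_sdiff_union {O A B : Finset (Fin m)} (hA : A ⊆ O) (hB : B ⊆ O) (hd : Disjoint A B) :
    (O \ (A ∪ B)).card = O.card - A.card - B.card := by
  rw [Finset.card_sdiff_of_subset (Finset.union_subset hA hB), Finset.card_union_of_disjoint hd]
  omega

/-- The arithmetic of the second-layer lower count: `3·[C(2k+1,3)(2k−3)‼ + 2(2k+1)(2k−1)‼] = (k+6)(2k+1)‼`.
[cite: MadrasSlade1993, Definition 1.2.4; lane plumbing] -/
private theorem secondLower_arith (k : ℕ) :
    3 * ((2 * k + 1).choose 3 * (2 * k - 3).doubleFactorial + 2 * (2 * k + 1) * (2 * k - 1).doubleFactorial) =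
      (k + 6) * (2 * k + 1).doubleFactorial := by
  rcases Nat.lt_or_ge k 2 with hk | hk
  · interval_cases k <;> decide
  · obtain ⟨i, rfl⟩ : ∃ i, k = i + 2 := ⟨k - 2, by omega⟩
    have e1 : 2 * (i + 2) + 1 = 2 * i + 3 + 2 := by ring
    have e2 : 2 * (i + 2) - 1 = 2 * i + 1 + 2 := by omega
    have e3 : 2 * (i + 2) - 3 = 2 * i + 1 := by omega
    rw [e1, e2, e3, Nat.doubleFactorial_add_two, Nat.doubleFactorial_add_two, show 2 * i + 3 = 2 * i + 1 + 2 by ring,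
      Nat.doubleFactorial_add_two]
    -- `C(2i+5, 3) · 6 = (2i+5)(2i+4)(2i+3)` via the descending factorial
    have hc : (2 * i + 1 + 2 + 2).choose 3 * 6 = (2 * i + 5) * (2 * i + 4) * (2 * i + 3) := by
      have h := Nat.descFactorial_eq_factorial_mul_choose (2 * i + 1 + 2 + 2) 3
      rw [show (3 : ℕ).factorial = 6 by decide] at h
      rw [mul_comm, ← h]
      simp only [Nat.descFactorial_succ, Nat.descFactorial_zero, mul_one]
      rw [show 2 * i + 1 + 2 + 2 - 0 = 2 * i + 5 by omega, show 2 * i + 1 + 2 + 2 - 1 = 2 * i + 4 by omega,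
        show 2 * i + 1 + 2 + 2 - 2 = 2 * i + 3 by omega]
      ring
    have h3 : 3 * ((2 * i + 1 + 2 + 2).choose 3 * (2 * i + 1).doubleFactorial) = (2 * i + 5) * (i + 2) * ((2 * i + 3) * (2 * i + 1).doubleFactorial) := by
      have : 3 * ((2 * i + 1 + 2 + 2).choose 3 * (2 * i + 1).doubleFactorial) * 2 = (2 * i + 5) * (i + 2) * ((2 * i + 3) * (2 * i + 1).doubleFactorial) * 2 := by
        calc 3 * ((2 * i + 1 + 2 + 2).choose 3 * (2 * i + 1).doubleFactorial) * 2
            = ((2 * i + 1 + 2 + 2).choose 3 * 6) * (2 * i + 1).doubleFactorial := by ring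
          _ = (2 * i + 5) * (2 * i + 4) * (2 * i + 3) * (2 * i + 1).doubleFactorial := by rw [hc]
          _ = _ := by ring
      omega
    rw [mul_add, h3]
    ring

open Classical in
/-- ★ THE (A, B) SUM ON `2k + 1` OUTSIDE POSITIONS: `Σ_{A, B ⊆ O disjoint} #twoParts (O ∖ (A ∪ B)) k = C(2k+1,3)(2k−3)‼ + 2(2k+1)(2k−1)‼` —
`A = B = ∅` (one triple), exactly one singleton (perfect matchings of `2k` points), `#A + #B ≥ 2` empty. [cite: MadrasSlade1993, Definition 1.2.4; lane lemma] -/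
theorem sum_card_twoParts_pairs {O : Finset (Fin m)} {k : ℕ} (hOc : O.card = 2 * k + 1) :
    ∑ AB ∈ (O.powerset ×ˢ O.powerset).filter (fun AB => Disjoint AB.1 AB.2), (twoParts (O \ (AB.1 ∪ AB.2)) k).card =
      (2 * k + 1).choose 3 * (2 * k - 3).doubleFactorial + 2 * (2 * k + 1) * (2 * k - 1).doubleFactorial := by
  set D := (O.powerset ×ˢ O.powerset).filter (fun AB : Finset (Fin m) × Finset (Fin m) => Disjoint AB.1 AB.2) with hD
  clear_value D
  have hmemD : ∀ AB ∈ D, AB.1 ⊆ O ∧ AB.2 ⊆ O ∧ Disjoint AB.1 AB.2 := by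
    intro AB hAB
    rw [hD, Finset.mem_filter, Finset.mem_product, Finset.mem_powerset, Finset.mem_powerset] at hAB
    exact ⟨hAB.1.1, hAB.1.2, hAB.2⟩
  have hg0 : ∀ AB ∈ D, 2 ≤ AB.1.card + AB.2.card → (twoParts (O \ (AB.1 ∪ AB.2)) k).card = 0 := by
    intro AB hAB hs
    obtain ⟨hA, hB, hd⟩ := hmemD AB hAB
    have hle := Finset.card_le_card (Finset.union_subset hA hB)
    rw [Finset.card_union_of_disjoint hd, hOc] at hle
    rw [twoParts_eq_empty_of_lt (W := O \ (AB.1 ∪ AB.2)) (k := k) (by rw [card_sdiff_union hA hB hd, hOc]; omega), Finset.card_empty]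
  have hg1 : ∀ AB ∈ D, AB.1.card + AB.2.card = 1 → (twoParts (O \ (AB.1 ∪ AB.2)) k).card = (2 * k - 1).doubleFactorial := by
    intro AB hAB hs
    obtain ⟨hA, hB, hd⟩ := hmemD AB hAB
    exact card_twoParts_of_card_eq (W := O \ (AB.1 ∪ AB.2)) (k := k) (by rw [card_sdiff_union hA hB hd, hOc]; omega)
  -- split the sum by `#A + #B ∈ {0}, {1}, {≥ 2}`
  have hsplit : ∑ AB ∈ D, (twoParts (O \ (AB.1 ∪ AB.2)) k).card =
      ∑ AB ∈ D.filter (fun AB => AB.1.card + AB.2.card = 0), (twoParts (O \ (AB.1 ∪ AB.2)) k).card +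
      (∑ AB ∈ D.filter (fun AB => AB.1.card + AB.2.card = 1), (twoParts (O \ (AB.1 ∪ AB.2)) k).card +
        ∑ AB ∈ D.filter (fun AB => 2 ≤ AB.1.card + AB.2.card), (twoParts (O \ (AB.1 ∪ AB.2)) k).card) := by
    rw [← Finset.sum_filter_add_sum_filter_not D (fun AB => AB.1.card + AB.2.card = 0)]
    congr 1
    rw [← Finset.sum_filter_add_sum_filter_not (D.filter fun AB => ¬ AB.1.card + AB.2.card = 0) (fun AB => AB.1.card + AB.2.card = 1)]
    congr 1
    · refine Finset.sum_congr ?_ (fun _ _ => rfl)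
      ext AB
      simp only [Finset.mem_filter]
      constructor
      · rintro ⟨⟨h1, -⟩, h3⟩; exact ⟨h1, h3⟩
      · rintro ⟨h1, h3⟩; exact ⟨⟨h1, by omega⟩, h3⟩
    · refine Finset.sum_congr ?_ (fun _ _ => rfl)
      ext AB
      simp only [Finset.mem_filter]
      constructor
      · rintro ⟨⟨h1, h2⟩, h3⟩; exact ⟨h1, by omega⟩
      · rintro ⟨h1, h3⟩; exact ⟨⟨h1, by omega⟩, by omega⟩
  -- `#A + #B = 0`: only `(∅, ∅)`
  have hD0 : D.filter (fun AB => AB.1.card + AB.2.card = 0) = {(∅, ∅)} := by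
    ext AB
    rw [Finset.mem_filter, Finset.mem_singleton, hD, Finset.mem_filter, Finset.mem_product, Finset.mem_powerset, Finset.mem_powerset]
    constructor
    · rintro ⟨-, h⟩
      have h1 : AB.1 = ∅ := Finset.card_eq_zero.1 (by omega)
      have h2 : AB.2 = ∅ := Finset.card_eq_zero.1 (by omega)
      exact Prod.ext h1 h2
    · rintro rfl; simp
  -- `#A + #B = 1`: the two families of singletons
  have hD1 : D.filter (fun AB => AB.1.card + AB.2.card = 1) =
      O.image (fun o => (({o} : Finset (Fin m)), (∅ : Finset (Fin m)))) ∪ O.image (fun o => (∅, {o})) := by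
    ext AB
    rw [Finset.mem_filter, Finset.mem_union, Finset.mem_image, Finset.mem_image, hD, Finset.mem_filter, Finset.mem_product, Finset.mem_powerset,
      Finset.mem_powerset]
    constructor
    · rintro ⟨⟨⟨hA, hB⟩, -⟩, hs⟩
      rcases Nat.eq_zero_or_pos AB.1.card with h1 | h1
      · have h2 : AB.2.card = 1 := by omega
        obtain ⟨o, ho⟩ := Finset.card_eq_one.1 h2
        refine Or.inr ⟨o, hB (by rw [ho]; simp), ?_⟩
        rw [← ho, ← Finset.card_eq_zero.1 h1]
      · have h1' : AB.1.card = 1 := by omega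
        obtain ⟨o, ho⟩ := Finset.card_eq_one.1 h1'
        refine Or.inl ⟨o, hA (by rw [ho]; simp), ?_⟩
        rw [← ho, ← Finset.card_eq_zero.1 (show AB.2.card = 0 by omega)]
    · rintro (⟨o, ho, rfl⟩ | ⟨o, ho, rfl⟩)
      · exact ⟨⟨⟨by simpa using ho, Finset.empty_subset _⟩, by simp⟩, by simp⟩
      · exact ⟨⟨⟨Finset.empty_subset _, by simpa using ho⟩, by simp⟩, by simp⟩
  have hdisj1 : Disjoint (O.image (fun o => (({o} : Finset (Fin m)), (∅ : Finset (Fin m))))) (O.image (fun o => (∅, {o}))) := by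
    rw [Finset.disjoint_left]
    rintro AB h1 h2
    obtain ⟨o, -, rfl⟩ := Finset.mem_image.1 h1
    obtain ⟨o', -, h⟩ := Finset.mem_image.1 h2
    have := congrArg Prod.fst h
    simp at this
  have hsum0 : ∑ AB ∈ D.filter (fun AB => AB.1.card + AB.2.card = 0), (twoParts (O \ (AB.1 ∪ AB.2)) k).card =
      (2 * k + 1).choose 3 * (2 * k - 3).doubleFactorial := by
    rw [hD0, Finset.sum_singleton]
    simp only [Finset.empty_union, Finset.sdiff_empty]
    exact card_twoParts_of_card_eq_succ hOc
  have hsum1 : ∑ AB ∈ D.filter (fun AB => AB.1.card + AB.2.card = 1), (twoParts (O \ (AB.1 ∪ AB.2)) k).card =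
      2 * (2 * k + 1) * (2 * k - 1).doubleFactorial := by
    rw [Finset.sum_congr rfl (fun AB hAB => hg1 AB (Finset.mem_filter.1 hAB).1 (Finset.mem_filter.1 hAB).2), Finset.sum_const, smul_eq_mul, hD1,
      Finset.card_union_of_disjoint hdisj1, Finset.card_image_of_injective _ (fun a b h => by simpa using congrArg Prod.fst h),
      Finset.card_image_of_injective _ (fun a b h => by simpa using congrArg Prod.snd h), hOc]
    ring
  have hsum2 : ∑ AB ∈ D.filter (fun AB => 2 ≤ AB.1.card + AB.2.card), (twoParts (O \ (AB.1 ∪ AB.2)) k).card = 0 :=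
    Finset.sum_eq_zero fun AB hAB => hg0 AB (Finset.mem_filter.1 hAB).1 (Finset.mem_filter.1 hAB).2
  rw [hsplit, hsum0, hsum1, hsum2, add_zero]

open Classical in
/-- ★★ THE (A, B, ρ) COUNT ON `2j − 1` LETTERS: `3 · #abData (2j−1) j p = (j+3) · (2j−5)‼`. [cite: MadrasSlade1993, Definition 1.2.4; lane theorem] -/
theorem three_mul_card_abData {j : ℕ} (hj : 3 ≤ j) (hp : p + 4 ≤ 2 * j - 1) :
    3 * (abData (2 * j - 1) j p hp).card = (j + 3) * (2 * j - 5).doubleFactorial := by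
  obtain ⟨k, rfl⟩ : ∃ k, j = k + 3 := ⟨j - 3, by omega⟩
  unfold abData
  rw [Finset.card_sigma, show 2 * (k + 3) - 1 - (k + 3) - 2 = k by omega,
    sum_card_twoParts_pairs (k := k) (by rw [card_outerPos hp]; omega), show k + 3 + 3 = k + 6 by ring,
    show 2 * (k + 3) - 5 = 2 * k + 1 by omega]
  exact secondLower_arith k

/-- ★★ THE GOOD-PARTITION COUNT ON `2j − 1` LETTERS: `3 · #goodParts (2j−1) j p = (j+3)·(2j−5)‼`. [cite: MadrasSlade1993, Definition 1.2.4; lane theorem] -/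
theorem three_mul_card_goodParts_secondLower {j : ℕ} (hj : 3 ≤ j) (hp : p + 4 ≤ 2 * j - 1) :
    3 * (goodParts (2 * j - 1) j p hp).card = (j + 3) * (2 * j - 5).doubleFactorial := by
  rw [card_goodParts_eq_card_abData hp (by omega), three_mul_card_abData hj hp]

/-- ★★★ THE SECOND-LAYER LOWER CLASS COUNT: `3 · #shapeClass j (2j−1) (topVec (2j−1) p) = (j+3)·(2j−5)‼·2^{2j−3}` for every `p + 4 ≤ 2j − 1`, `j ≥ 3`
(independent of `p`; `j = 4, 5, 6, 7`: `224, 5120, 161280, 6451200` per position). [cite: MadrasSlade1993, Definition 1.2.4; lane theorem] -/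
theorem three_mul_card_shapeClass_secondLower {j p : ℕ} (hj : 3 ≤ j) (hp : p + 4 ≤ 2 * j - 1) :
    3 * (shapeClass j (2 * j - 1) (topVec (2 * j - 1) p)).card = (j + 3) * ((2 * j - 5).doubleFactorial * 2 ^ (2 * j - 3)) := by
  rw [card_shapeClass_topVec hp, ← mul_assoc, three_mul_card_goodParts_secondLower hj hp, show 2 * j - 1 - 2 = 2 * j - 3 by omega]
  ring

open Classical in
/-- ★★★ THE SECOND-LAYER LOWER CENSUS FOR EVERY `j ≥ 3`: `3·V'_j = (2j−4)(j+3)(2j−5)‼·2^{2j−3}`, `V'_j = secondShapeSumBelow j` — the classes with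
`2j − 4` breaks on `2j − 1` letters are the one-block classes `topVec (2j−1) p`, `p ≤ 2j − 5` (λ1), each counted above. This is the second conjunct of
`SAWCountZdSymbolSecondCancellation.SecondLayerSums j` (the census values `896, 30720, 1290240` for `j = 4, 5, 6` and the BLIND-predicted
`M_7(13,10) = 64 512 000`, kit j306081, register «Am. BQ» cell BQ-1). [cite: MadrasSlade1993, §1.1 eq. (1.1.8) p. 5; Definition 1.2.4]
[cite: ClisbyLiangSlade2007, §3.3 eqs. (29)/(31); lane theorem] -/
theorem three_mul_secondShapeSumBelow (j : ℕ) (hj : 3 ≤ j) :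
    3 * secondShapeSumBelow j = (2 * j - 4) * (j + 3) * ((2 * j - 5).doubleFactorial * 2 ^ (2 * j - 3)) := by
  unfold secondShapeSumBelow
  have hval : ∀ p ∈ Finset.range (2 * j - 4),
      3 * (if AdjValid (topVec (2 * j - 1) p) ∧ breaks (topVec (2 * j - 1) p) = 2 * j - 4 then (shapeClass j (2 * j - 1) (topVec (2 * j - 1) p)).card
        else 0) = (j + 3) * ((2 * j - 5).doubleFactorial * 2 ^ (2 * j - 3)) := by
    intro p hp
    rw [Finset.mem_range] at hp
    have hp4 : p + 4 ≤ 2 * j - 1 := by omega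
    rw [if_pos ⟨adjValid_topVec hp4, by rw [breaks_topVec hp4]; omega⟩, three_mul_card_shapeClass_secondLower hj hp4]
  have hvan : ∀ A ∈ (Finset.univ : Finset (Fin (2 * j - 1) → Bool)), A ∉ (Finset.range (2 * j - 4)).image (topVec (2 * j - 1)) →
      (if AdjValid A ∧ breaks A = 2 * j - 4 then (shapeClass j (2 * j - 1) A).card else 0) = 0 := by
    intro A _ hA
    split_ifs with h
    · by_contra hne
      obtain ⟨κ, hκ⟩ := Finset.card_pos.1 (Nat.pos_of_ne_zero hne)
      obtain ⟨p, hp4, rfl⟩ := exists_eq_topVec_of_mem_shapeClass (by rw [h.2]; omega) hκ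
      exact hA (Finset.mem_image.2 ⟨p, Finset.mem_range.2 (by omega), rfl⟩)
    · rfl
  have hinj : Set.InjOn (topVec (2 * j - 1)) ↑(Finset.range (2 * j - 4)) := by
    intro p hp p' hp' h
    rw [Finset.mem_coe, Finset.mem_range] at hp hp'
    exact topVec_injOn (by omega) (by omega) h
  rw [← Finset.sum_subset (Finset.subset_univ _) hvan, Finset.sum_image hinj, Finset.mul_sum, Finset.sum_congr rfl hval, Finset.sum_const,
    Finset.card_range, smul_eq_mul]
  ring

end Count

end WordTypes

end Literature.Probability.RandomPlanarGeometry.SAW.Zd
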